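import Literature.NumberTheory.EllipticCurves.LambdaAdicSelmerDataOrdinaryProofs
import Literature.NumberTheory.EllipticCurves.LocalPointsModKernelOfReductionMultiplicativeProofs
import HarnessLib

/-!
# Clause `(p)` of Howard's Selmer criterion for `𝔖_p(K_∞)` at places `v ∣ p` of MULTIPLICATIVE reduction, and
# `f(𝔖_p(K_∞)) ⊆ H¹_{F_𝔮}(K, T_𝔮)` for curves multiplicative above `p` (ORD-ASCENT at multiplicative `p`; theorems only)

Topic `NumberTheory/EllipticCurves`; namespace `WeierstrassCurve.LambdaAdicSelmerData` (LEAD `bsd-wall-utd-p1` g26, crux r205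
stmt-BirchSwinnertonDyer-24737 `TwinAlgMuZeroAtThree`, line `beta-road` v10, K2 stub `stub_howardOutputsOfFamily`, D1-twin controls:
the `hf` input «control image ⊆ pinned `H¹_{F_𝔮}`» of x10b's `controlGlue_of_clauses`, which the print lane takes from
`toEisensteinH1Linear_mem_ordinarySelmer_of_thm413Hypotheses` (good ordinary)).

x9's `LambdaAdicSelmerDataOrdinaryProofs` proves clause `(p)` at a GOOD ORDINARY `v ∣ p` through the finiteness of `Ẽ(𝔽_{q_v^{N₀}})`
(loss of exponent `a = #T`, uniformity hypothesis `hres` on the residue degrees of `κ` at `v`).  At a MULTIPLICATIVE `v ∣ p` the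
component group over `K̄_v` is infinite and that route is closed; instead the two abstract inputs of
`proj_conj_cocycle_sub_coboundary_mem_torsionFilAt` hold OUTRIGHT with `a = 0` and no `hres`
(`LocalPointsModKernelOfReductionMultiplicativeProofs`: `E₁(K̄_v) = Ψ(1 + 𝔪)` by the PROVED Tate uniformisation, and `p^k`-th roots
preserve `1 + 𝔪` and invariance modulo `1 + 𝔪` in residue characteristic `p`; `p` odd for the sign twist).

* **`nsmul_localization_proj_toEisensteinH1Linear_mem_ordinaryCore_of_hasMultiplicativeReductionAt`** — clause `(p)`, `a = 0`;
* **`toEisensteinH1Linear_mem_ordinarySelmer_of_multiplicative`**, `toEisensteinH1Linear_mem_selmerSubmodule_of_multiplicative` —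
  `f(𝔖) ⊆ H¹_{F_𝔮}(K, T_𝔮)` / `⊆ H_m` for a curve multiplicative at every `v ∣ p` (for the twin of crux 24737: `Rank1Residual.Mult W′ 3`
  ⟹ multiplicative above `3` over any number field, `UniversalToricDescentTwinTateLineAtThree`).

BSD is not proved by any of this.

## References
* [Howard2004HeegnerKolyvagin] B. Howard, Compositio Math. 140 (2004), §2.2 Lemma 2.2.7, Prop. 2.2.8, §3.1.
* [GreenbergLNM1716] R. Greenberg, LNM 1716 (1999), §2 pp. 70–76.
* [SilvermanATAEC1994] J. H. Silverman, *ATAEC*, §V.4, Thm. V.5.3.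
-/

noncomputable section

open scoped TensorProduct Topology ContRepresentation Classical NumberField NNReal
open Field CategoryTheory NumberField IsDedekindDomain
open Literature.NumberTheory.GaloisRepresentations Literature.NumberTheory.EllipticCurves
open Literature.NumberTheory.EllipticCurves.ZpExtension (eisensteinLevel)

universe u

namespace WeierstrassCurve.LambdaAdicSelmerData

variable {K : Type} [Field K] [NumberField K] {V : WeierstrassCurve K} [V.IsElliptic] {p : ℕ} [hp : Fact p.Prime]
  {κ : ZpExtension K p} {γ : absoluteGaloisGroup K} (D : V.LambdaAdicSelmerData κ γ) {m : ℕ} (hm : 1 ≤ m)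

section Linear

variable (t : ∀ k, (V.torsionGaloisModule ((p : ℤ) ^ (k + 1))).toContRepresentation →ⁱL
    (V.torsionGaloisModule ((p : ℤ) ^ k)).toContRepresentation)
  (ht : ∀ k (P : geomTorsion V ((p : ℤ) ^ (k + 1))), t k P = V.geomTorsionReduce p k P)
  (I : ZpExtension.EisensteinH1Data (κ.unitTwist (-1)) (fun k ↦ V.torsionGaloisModule ((p : ℤ) ^ k)) t hm)

include ht


/-- **Clause `(p)` at a place `v ∣ p` of MULTIPLICATIVE reduction, for `h = f s`, with NO loss of exponent (`a = 0`) and NO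
uniformity hypothesis on `κ`.** At a multiplicative `v ∣ p` (`p` odd) the two local inputs of
`proj_conj_cocycle_sub_coboundary_mem_torsionFilAt` hold outright (`LocalPointsModKernelOfReductionMultiplicativeProofs`, via the Tate
uniformisation with `E₁(K̄_v) = Ψ(1 + 𝔪)`): (div₁) `E₁(K̄_v)` is `p^k`-divisible, (div_H) the invariants of `E(K̄_v)/E₁` under any
subgroup of `Γ_{K_v}` are `p^k`-divisible — whereas the good-ordinary argument of
`nsmul_localization_proj_toEisensteinH1Linear_mem_ordinaryCore` (finiteness of `Ẽ(𝔽_{q_v^{N₀}})`) has no multiplicative analogue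
(infinite component group over `K̄_v`).  Hence for every `k`, `loc_v (proj k (f s))` lies in the strict ordinary core
`ker (H¹(K_v, W_k) → H¹(K_v, W_k / Fil_v W_k))`. [cite: GreenbergLNM1716, §2 pp. 70–76]
[cite: Howard2004HeegnerKolyvagin, §2.2 Lemma 2.2.7, Prop. 2.2.8 and §3.1 (H¹_ord)] [cite: SilvermanATAEC1994, §V.4] -/
theorem nsmul_localization_proj_toEisensteinH1Linear_mem_ordinaryCore_of_hasMultiplicativeReductionAt
    (hγ : κ.IsTopGenerator γ)
    (hE : ∀ P : V.toAffine.Point, p • P = 0 → P = 0) (s : D.S) {v : HeightOneSpectrum (𝓞 K)}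
    (hp2 : p ≠ 2) (hpv : (p : 𝓞 K) ∈ v.asIdeal) (hmult : V.HasMultiplicativeReductionAt v) :
    ∃ a : ℕ, ∀ k,
      p ^ a • galoisCohomology.localization
          ((κ.unitTwist (-1)).eisensteinTwist (V.torsionGaloisModule ((p : ℤ) ^ k)) hm k) (Sum.inr v) 1
          (I.proj k (D.toEisensteinH1Linear hm t ht I hγ hE s)) ∈
        (V.ordinaryFiltrationAt v t ht).ordinaryCore hm k := by
  -- at a multiplicative place no exponent is lost: `a = 0`
  refine ⟨0, fun k ↦ ?_⟩
  haveI := κ.fintypeQuotientLayer (eisensteinLevel (p := p) hm k)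
  rw [D.proj_toEisensteinH1Linear hm t ht I hγ hE s k le_rfl, D.eisensteinComponent_apply hm k _ le_rfl s]
  obtain ⟨z, hz⟩ := oneCocycleClass_surjective
    (subgroupRep (V.torsionGaloisModule ((p : ℤ) ^ k)).toTopRep (κ.layerSubgroup (eisensteinLevel (p := p) hm k)))
    (D.proj (eisensteinLevel (p := p) hm k) s k)
  have hcl : (κ.unitTwist (-1)).coresEisenstein (V.torsionGaloisModule ((p : ℤ) ^ k)) hm k
        (κ.layerSubgroup (eisensteinLevel (p := p) hm k)) (layerSubgroup_le_unitTwist_layerSubgroup hm le_rfl)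
        (κ.isOpen_layerSubgroup _) (oneCocycleClass _ (((p ^ 0 : ℕ) : ℤ) • z)) =
      p ^ 0 • (κ.unitTwist (-1)).coresEisenstein (V.torsionGaloisModule ((p : ℤ) ^ k)) hm k
        (κ.layerSubgroup (eisensteinLevel (p := p) hm k)) (layerSubgroup_le_unitTwist_layerSubgroup hm le_rfl)
        (κ.isOpen_layerSubgroup _) (D.proj (eisensteinLevel (p := p) hm k) s k) := by
    rw [oneCocycleClass_smul, Nat.cast_smul_eq_nsmul, map_nsmul, hz]
  rw [← map_nsmul, ← hcl]
  refine (κ.unitTwist (-1)).localization_coresEisenstein_mem_ordinaryCore (fun j ↦ V.torsionGaloisModule ((p : ℤ) ^ j))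
    t hm k (κ.layerSubgroup _) (layerSubgroup_le_unitTwist_layerSubgroup hm le_rfl) (κ.isOpen_layerSubgroup _)
    (V.ordinaryFiltrationAt v t ht) _ fun g ↦ ?_
  -- the cocycle hypothesis, from (div₁) and (div_H) at the multiplicative place `v`
  exact D.proj_conj_cocycle_sub_coboundary_mem_torsionFilAt _ k 0 s g z hz
    (fun Q hQ ↦ V.exists_nsmul_pow_eq_of_mem_localKernelOfReduction_of_hasMultiplicativeReductionAt hpv hmult k hQ)
    (fun R hR ↦ by
      obtain ⟨S, hS, hSR⟩ := V.exists_fixedModKernel_nsmul_pow_eq_of_hasMultiplicativeReductionAt hp2 hpv hmult _ k R hR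
      exact ⟨S, hS, by rwa [pow_zero, one_smul]⟩)

/-- **`f(𝔖_p(K_∞)) ⊆ H¹_{F_𝔮}(K, T_𝔮)` for a curve MULTIPLICATIVE above `p`** (`p` odd; Howard, Lemma 2.2.7 / Prop. 2.2.8): for every
`s ∈ 𝔖` and every finite `S ⊇ badPlaces`, `f s ∈ H¹_{F_𝔮}(K, T_𝔮)` — the three clauses of `mem_ordinarySelmer_of_local` are
`toEisensteinH1Linear_hur`, `toEisensteinH1Linear_hS_of_kodairaNeron` (x9, generic) and the multiplicative `(p)`-clause above; no
residue-degree hypothesis on `κ` is needed. [cite: Howard2004HeegnerKolyvagin, §2.2 Lemma 2.2.7 and Prop. 2.2.8; Def. 3.1.2]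
[cite: GreenbergLNM1716, §2 pp. 70–76] -/
theorem toEisensteinH1Linear_mem_ordinarySelmer_of_multiplicative (hγ : κ.IsTopGenerator γ) (hE : ∀ P : V.toAffine.Point, p • P = 0 → P = 0)
    (S : Finset (HeightOneSpectrum (𝓞 K))) (hS : ∀ v ∈ V.badPlaces (𝓞 K), v ∈ S) (s : D.S)
    (hp2 : p ≠ 2) (hmult : ∀ v : HeightOneSpectrum (𝓞 K), (p : 𝓞 K) ∈ v.asIdeal → V.HasMultiplicativeReductionAt v) :
    D.toEisensteinH1Linear hm t ht I hγ hE s ∈ I.ordinarySelmer S (fun v _ ↦ V.ordinaryFiltrationAt v t ht) :=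
  I.mem_ordinarySelmer_of_local S (fun v _ ↦ V.ordinaryFiltrationAt v t ht) _
    (fun v hv ↦ D.nsmul_localization_proj_toEisensteinH1Linear_mem_ordinaryCore_of_hasMultiplicativeReductionAt hm t ht I
      hγ hE s hp2 hv (hmult v hv))
    (D.toEisensteinH1Linear_hS_of_kodairaNeron hm t ht I hγ hE S s) (D.toEisensteinH1Linear_hur hm t ht I hγ hE S hS s)


/-- **`f(𝔖_p(K_∞)) ⊆ H_m`** for a curve multiplicative above `p` — the `Λ`-submodule form (the target `H_m` of the control map
in Howard's Prop. 2.2.8; the `hf` input of the ControlGlue assembly). [cite: Howard2004HeegnerKolyvagin, §2.2 Prop. 2.2.8 and Def. 2.2.3] -/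
theorem toEisensteinH1Linear_mem_selmerSubmodule_of_multiplicative (hγ : κ.IsTopGenerator γ) (hE : ∀ P : V.toAffine.Point, p • P = 0 → P = 0)
    (S : Finset (HeightOneSpectrum (𝓞 K))) (hS : ∀ v ∈ V.badPlaces (𝓞 K), v ∈ S) (s : D.S)
    (hp2 : p ≠ 2) (hmult : ∀ v : HeightOneSpectrum (𝓞 K), (p : 𝓞 K) ∈ v.asIdeal → V.HasMultiplicativeReductionAt v)
    (h𝓕 : ∀ (k : ℕ) (c : IwasawaAlgebra.EisensteinCoeff p m k)
      (x : galoisCohomology ((κ.unitTwist (-1)).eisensteinTwist (V.torsionGaloisModule ((p : ℤ) ^ k)) hm k) 1),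
      x ∈ ((κ.unitTwist (-1)).eisensteinSelmerStructure (fun k ↦ V.torsionGaloisModule ((p : ℤ) ^ k)) t hm S
          (fun v _ ↦ V.ordinaryFiltrationAt v t ht) k).selmerGroup →
        galoisCohomology.map ((κ.unitTwist (-1)).eisensteinTwistSMulHom (V.torsionGaloisModule ((p : ℤ) ^ k)) hm k c) 1 x ∈
          ((κ.unitTwist (-1)).eisensteinSelmerStructure (fun k ↦ V.torsionGaloisModule ((p : ℤ) ^ k)) t hm S
            (fun v _ ↦ V.ordinaryFiltrationAt v t ht) k).selmerGroup) :
    D.toEisensteinH1Linear hm t ht I hγ hE s ∈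
      I.selmerSubmodule ((κ.unitTwist (-1)).eisensteinSelmerStructure (fun k ↦ V.torsionGaloisModule ((p : ℤ) ^ k)) t hm S
        (fun v _ ↦ V.ordinaryFiltrationAt v t ht)) h𝓕 :=
  D.toEisensteinH1Linear_mem_ordinarySelmer_of_multiplicative hm t ht I hγ hE S hS s hp2 hmult


end Linear

end WeierstrassCurve.LambdaAdicSelmerData

end
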